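import Summits.QuantumFields.YangMills.Theorems.UnitScaleTiltProp7CoerciveOfInverseBound
import HarnessLib

/-!
# Route `UnitScaleTilt`, crux K1 «MinimiserStabilityRegPr» (stmt-QuantumFields-19200) — ARCHITECTURE (A′) «HCOW-VIA-Σ» (★★OWNER RULING g28-№13): THE GENERIC-SLOT TWIN OF ★w4 g8's
# HILBERT LEMMA ✓`Prop7CoerciveOfInverseBound` — COERCIVITY OF `Δ_a = Δx + D·Rr·D* + Qc*·a·Qc` FROM ALMOST-POSITIVITY OF `Δx` AND A BOUNDED RIGHT INVERSE, for ANY symmetric idempotent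
# gauge projector `Rr` and ANY averaging `Qc` (so the (COERC) row of ✓`Prop7HcoWOfSigmaRowsSlots.hcoW_of_sigmaRowsW_slots` is fed for print's COMB pair as well as for `R_S`∕`Q_k`)

Cell `ym3-torus` ∕ fleet seat `ym-ust-19200-p1` (gen 17, route-R E′ lead ∕ namer).  THEOREMS ONLY (0 `def`, 0 `sorry`); `--supports stmt-QuantumFields-19200`, count-neutral.
YM₃ on T³ is a ladder rung (R3), not the Clay problem; nothing here claims the stub, the crux, `hcoW`, HESS at the critical configuration, d = 4 or the mass gap.

WHY (namer WORD 12 (S-ii) + WORD 14).  ✓`coercive_laplaceA_of_almostPos_of_inverse_bound` (w4 g8) turns {almost-positivity of the Hessian letter, a bounded right inverse `G₀` of `Δ_a`} into the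
quantitative coercivity row — at the EX lane's fixed pair (`R_S`, `Q_k`) of ✓`laplaceA`.  The competitor representative of `hcoW` carries print's COMB Landau condition, so the door of
record may have to be instantiated at the comb pair; this file is the same lemma over lit-balaban's abstract `laplaceAK Δ D Rr D† Qc Qc† a` (any finite-dimensional `𝕜`-inner-product
spaces): §1 `re⟪y, Δ_a y⟫ = re⟪y, Δy⟫ + ‖Rr(D†y)‖² + re a·‖Qc y‖²` for `Rr` symmetric idempotent, almost-positivity transfer, symmetry of `Δ_a`, and ★★★ `coercive_laplaceAK_of_almostPos_of_inverse_bound`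
(via ✓`re_inner_ge_of_almostPos_of_inv_bound` + ✓`inv_bound_of_rightInverse`); §2 the member reading with `D := DL2 U₀`, `D* := DstarL2 U₀ = (DL2 U₀)†` (✓`adjoint_DL2`) and slots `Rr`, `Qc`
= the (COERC) conjunct of ✓`hcoW_of_sigmaRowsW_slots` VERBATIM with `γ := B⁻¹`.
HONEST SCOPE.  Linear algebra; the almost-positivity of `Δx` ((3.10), the EX namer's row) and the right-inverse bound (`norm_G₀`, N06) are HYPOTHESES; nothing of print is asserted.

References: T. Bałaban, CMP 99 (1985) 389–434 [Balaban1985BackgroundPropagators] ((3.10) p.392, (3.21)–(3.26) pp.394–395, Thm 3.3 (3.46)–(3.47) pp.397–398, Thm 3.11 p.416);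
CMP 102 (1985) 277–309 [Balaban1985Variational] ((106)–(111) p.294, (141)–(142) p.299).
-/

set_option autoImplicit false
noncomputable section

open scoped InnerProductSpace ComplexConjugate BigOperators

namespace Summit.QuantumFields.YangMills.Theorems.Prop7CoerciveSlotsOfInverseBound

open Literature.MathematicalPhysics.QuantumFieldTheory.Balaban1983to89
open Literature.MathematicalPhysics.QuantumFieldTheory.Balaban1983to89.T3ContinuumYM3Torus
open B11Eq103H1Complex (SiteL2K BondL2K laplaceAK laplaceAK_apply)
open Summit.QuantumFields.YangMills.Theorems.Prop7SectET3Transport (periodsT3)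
open Summit.QuantumFields.YangMills.Theorems.Prop7SectET3HilbertLetters (W₂ DL2 DstarL2 adjoint_DL2)
open Summit.QuantumFields.YangMills.Theorems.Prop7CoerciveOfInverseBound (re_inner_ge_of_almostPos_of_inv_bound inv_bound_of_rightInverse)

/-! ## §1 Abstract slots -/

section Abstract

variable {𝕜 : Type*} [RCLike 𝕜] {E : Type*} [NormedAddCommGroup E] [InnerProductSpace 𝕜 E] [FiniteDimensional 𝕜 E]
  {F : Type*} [NormedAddCommGroup F] [InnerProductSpace 𝕜 F] [FiniteDimensional 𝕜 F]
  {S : Type*} [NormedAddCommGroup S] [InnerProductSpace 𝕜 S] [FiniteDimensional 𝕜 S]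
  (Δ : E →ₗ[𝕜] E) (D : S →ₗ[𝕜] E) (Rr : S →ₗ[𝕜] S) (Q : E →ₗ[𝕜] F) (a : 𝕜)

omit [FiniteDimensional 𝕜 S] in
/-- For a symmetric idempotent `Rr`: `re⟪u, Rr u⟫ = ‖Rr u‖²`. [folklore] -/
theorem re_inner_proj_self (hR : Rr.IsSymmetric) (hRR : ∀ u, Rr (Rr u) = Rr u) (u : S) :
    RCLike.re ⟪u, Rr u⟫_𝕜 = ‖Rr u‖ ^ 2 := by
  have h1 : ⟪u, Rr u⟫_𝕜 = ⟪Rr u, Rr u⟫_𝕜 := by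
    conv_lhs => rw [← hRR u]
    exact (hR u (Rr u)).symm
  rw [h1, inner_self_eq_norm_sq_to_K]
  norm_cast

/-- ★ **`re⟪y, Δ_a y⟫ = re⟪y, Δy⟫ + ‖Rr(D†y)‖² + re a·‖Qy‖²`** for `Δ_a = laplaceAK Δ D Rr D† Q Q† a`, `Rr` symmetric idempotent ([B9] (3.26), both penalties as squares).
[cite: Balaban1985BackgroundPropagators, (3.26) p.395, (3.8) p.392] -/
theorem re_inner_laplaceAK_eq (hR : Rr.IsSymmetric) (hRR : ∀ u, Rr (Rr u) = Rr u) (y : E) :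
    RCLike.re ⟪y, laplaceAK Δ D Rr (LinearMap.adjoint D) Q (LinearMap.adjoint Q) a y⟫_𝕜
      = RCLike.re ⟪y, Δ y⟫_𝕜 + ‖Rr (LinearMap.adjoint D y)‖ ^ 2 + RCLike.re a * ‖Q y‖ ^ 2 := by
  rw [laplaceAK_apply, inner_add_right, inner_add_right, map_add, map_add]
  have h2 : ⟪y, D (Rr (LinearMap.adjoint D y))⟫_𝕜 = ⟪LinearMap.adjoint D y, Rr (LinearMap.adjoint D y)⟫_𝕜 := by
    rw [LinearMap.adjoint_inner_left]
  have h3 : RCLike.re ⟪y, LinearMap.adjoint Q (a • Q y)⟫_𝕜 = RCLike.re a * ‖Q y‖ ^ 2 := by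
    rw [LinearMap.adjoint_inner_right, inner_smul_right, inner_self_eq_norm_sq_to_K]
    rw [show (a * ((‖Q y‖ : 𝕜) ^ 2) : 𝕜) = a * (((‖Q y‖ ^ 2 : ℝ)) : 𝕜) by push_cast; ring, RCLike.re_mul_ofReal]
  rw [h2, re_inner_proj_self Rr hR hRR, h3]

/-- Almost-positivity of `Δ` transfers to `Δ_a` (`re a ≥ 0`). [cite: Balaban1985BackgroundPropagators, (3.10) p.392, (3.26) p.395] -/
theorem almostPos_laplaceAK_of_almostPos (hR : Rr.IsSymmetric) (hRR : ∀ u, Rr (Rr u) = Rr u) (ha : 0 ≤ RCLike.re a) {θ : ℝ}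
    (hθ : ∀ y : E, -(θ * ‖y‖ ^ 2) ≤ RCLike.re ⟪y, Δ y⟫_𝕜) (y : E) :
    -(θ * ‖y‖ ^ 2) ≤ RCLike.re ⟪y, laplaceAK Δ D Rr (LinearMap.adjoint D) Q (LinearMap.adjoint Q) a y⟫_𝕜 := by
  rw [re_inner_laplaceAK_eq Δ D Rr Q a hR hRR]
  have h1 := hθ y
  have h2 : 0 ≤ ‖Rr (LinearMap.adjoint D y)‖ ^ 2 := sq_nonneg _
  have h3 : 0 ≤ RCLike.re a * ‖Q y‖ ^ 2 := mul_nonneg ha (sq_nonneg _)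
  linarith

/-- `Δ_a` is symmetric when `Δ` and `Rr` are and `a` is real (`conj a = a`). [cite: Balaban1985Variational, p.293] -/
theorem laplaceAK_isSymmetric (hΔ : Δ.IsSymmetric) (hR : Rr.IsSymmetric) (ha : (starRingEnd 𝕜) a = a) :
    (laplaceAK Δ D Rr (LinearMap.adjoint D) Q (LinearMap.adjoint Q) a).IsSymmetric := by
  intro x y
  simp only [laplaceAK_apply, inner_add_left, inner_add_right]
  refine congrArg₂ (· + ·) (congrArg₂ (· + ·) (hΔ x y) ?_) ?_
  · rw [← LinearMap.adjoint_inner_right, hR, LinearMap.adjoint_inner_left]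
  · rw [LinearMap.adjoint_inner_left, inner_smul_left, LinearMap.adjoint_inner_right, inner_smul_right, ha]

/-- ★★★ **COERCIVITY OF `Δ_a` (generic slots) FROM ALMOST-POSITIVITY OF `Δ` AND A BOUNDED RIGHT INVERSE**: `Δ` symmetric with `re⟪y,Δy⟫ ≥ −θ‖y‖²`, `Rr` symmetric idempotent, `a` real ≥ 0,
`Δ_a ∘ G₀ = id`, `‖G₀f‖ ≤ B‖f‖`, `θB < 1` ⟹ `B⁻¹‖y‖² ≤ re⟪y, Δ_a y⟫` for all `y` — ✓`re_inner_ge_of_almostPos_of_inv_bound` ∘ ✓`inv_bound_of_rightInverse`.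
[cite: Balaban1985BackgroundPropagators, Thm 3.11 p.416, Thm 3.3 (3.46)–(3.47) pp.397–398; Balaban1985Variational, (106)–(111) p.294] -/
theorem coercive_laplaceAK_of_almostPos_of_inverse_bound (hΔ : Δ.IsSymmetric) (hR : Rr.IsSymmetric) (hRR : ∀ u, Rr (Rr u) = Rr u)
    (ha : (starRingEnd 𝕜) a = a) (ha0 : 0 ≤ RCLike.re a) {θ B : ℝ} (hB : 0 < B) (hθB : θ * B < 1)
    (hθ : ∀ y : E, -(θ * ‖y‖ ^ 2) ≤ RCLike.re ⟪y, Δ y⟫_𝕜)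
    (G₀ : E →ₗ[𝕜] E) (hG : laplaceAK Δ D Rr (LinearMap.adjoint D) Q (LinearMap.adjoint Q) a ∘ₗ G₀ = LinearMap.id) (hGB : ∀ f, ‖G₀ f‖ ≤ B * ‖f‖)
    (y : E) :
    B⁻¹ * ‖y‖ ^ 2 ≤ RCLike.re ⟪y, laplaceAK Δ D Rr (LinearMap.adjoint D) Q (LinearMap.adjoint Q) a y⟫_𝕜 :=
  re_inner_ge_of_almostPos_of_inv_bound (laplaceAK_isSymmetric Δ D Rr Q a hΔ hR ha) hB hθB
    (almostPos_laplaceAK_of_almostPos Δ D Rr Q a hR hRR ha0 hθ) (inv_bound_of_rightInverse _ G₀ hG hGB) y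

end Abstract

/-! ## §2 The member reading with slots (`D := DL2 U₀`, `D* := DstarL2 U₀ = (DL2 U₀)†`) -/

section Member

variable (F : T3Family) (n K : ℕ) (c₀ : ℝ) [Fact (0 < c₀)]
  {CW : Type*} [NormedAddCommGroup CW] [InnerProductSpace ℂ CW] [FiniteDimensional ℂ CW]

/-- ★★★ **THE (COERC) ROW OF ✓`hcoW_of_sigmaRowsW_slots` FROM {almost-positivity of `Δx(U₀)`, a bounded right inverse of the slot operator}**, for ANY symmetric idempotent projector slot `Rr`
and ANY averaging slot `Qc` (print's comb pair or the symmetric pair), real weight `aQ ≥ 0`: `(1∕B)·‖y‖² ≤ re⟪y, laplaceAK (Δx U₀) (D_{U₀}) Rr (D*_{U₀}) Qc Qc† aQ y⟫`.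
[cite: Balaban1985BackgroundPropagators, Thm 3.11 p.416, (3.26) p.395; Balaban1985Variational, (141)-(142) p.299] -/
theorem coercive_slots_of_almostPos_of_inverse_bound (U₀ : GaugeField (F.P K) 0 (Matrix.specialUnitaryGroup (Fin 2) ℂ))
    (Δx : BondL2K ℂ 3 (periodsT3 F K) c₀ W₂ →ₗ[ℂ] BondL2K ℂ 3 (periodsT3 F K) c₀ W₂) (hΔx : Δx.IsSymmetric)
    (Rr : SiteL2K ℂ 3 (periodsT3 F K) c₀ W₂ →ₗ[ℂ] SiteL2K ℂ 3 (periodsT3 F K) c₀ W₂) (hR : Rr.IsSymmetric) (hRR : ∀ u, Rr (Rr u) = Rr u)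
    (Qc : BondL2K ℂ 3 (periodsT3 F K) c₀ W₂ →ₗ[ℂ] CW) {aQ : ℝ} (ha : 0 ≤ aQ) {θ B : ℝ} (hB : 0 < B) (hθB : θ * B < 1)
    (hθ : ∀ y : BondL2K ℂ 3 (periodsT3 F K) c₀ W₂, -(θ * ‖y‖ ^ 2) ≤ RCLike.re ⟪y, Δx y⟫_ℂ)
    (G₀ : BondL2K ℂ 3 (periodsT3 F K) c₀ W₂ →ₗ[ℂ] BondL2K ℂ 3 (periodsT3 F K) c₀ W₂)
    (hG : laplaceAK Δx (DL2 F n K c₀ U₀) Rr (DstarL2 F n K c₀ U₀) Qc (LinearMap.adjoint Qc) ((aQ : ℝ) : ℂ) ∘ₗ G₀ = LinearMap.id)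
    (hGB : ∀ f, ‖G₀ f‖ ≤ B * ‖f‖) (y : BondL2K ℂ 3 (periodsT3 F K) c₀ W₂) :
    B⁻¹ * ‖y‖ ^ 2 ≤ RCLike.re ⟪y, laplaceAK Δx (DL2 F n K c₀ U₀) Rr (DstarL2 F n K c₀ U₀) Qc (LinearMap.adjoint Qc) ((aQ : ℝ) : ℂ) y⟫_ℂ := by
  have hD : DstarL2 F n K c₀ U₀ = LinearMap.adjoint (DL2 F n K c₀ U₀) := (adjoint_DL2 U₀).symm
  rw [hD] at hG ⊢
  have ha' : (starRingEnd ℂ) ((aQ : ℝ) : ℂ) = ((aQ : ℝ) : ℂ) := Complex.conj_ofReal _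
  have ha0 : 0 ≤ RCLike.re (((aQ : ℝ) : ℂ)) := by simpa [RCLike.re_to_complex] using ha
  exact coercive_laplaceAK_of_almostPos_of_inverse_bound Δx (DL2 F n K c₀ U₀) Rr Qc _ hΔx hR hRR ha' ha0 hB hθB hθ G₀ hG hGB y

end Member

end Summit.QuantumFields.YangMills.Theorems.Prop7CoerciveSlotsOfInverseBound

end
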